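import Summits.BirchSwinnertonDyer.BirchSwinnertonDyer.Theorems.AdditiveBranchIMCGordTwoRankOneSplitGlue
import Summits.BirchSwinnertonDyer.Rank1Residual.Additive.TwistedBranchPAdicGrossZagierEndState
import HarnessLib

/-!
# Route `AdditiveBranchIMC` (rung K1), crux `GordTwoRankOne` (item 19358): the certificate child
# `GordTwoRankOneClassCert` (item 19499) IS Schneider's non-degeneracy on the cell — both directions,
# in the kernel (cell `bsd-addord`, seat `bsd-addord-k1-c3` gen 10; `--supports stmt-BirchSwinnertonDyer-19358 --as helper`)

HONEST FRAMING. THEOREMS ONLY: no definition, no named fact minted, nothing asserted, nothing booked; the crux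
and its child 19499 stay OPEN. The cell's standing caution H3 says, in prose, that at CLASS level (`∀ W`) the
rank-one lower half of 19358 needs `p`-adic height non-degeneracy — «`A′ ≠ 0 ⟺ Reg_p ≠ 0` given `L′(E,1) ≠ 0`,
Schneider-type, MATH-BOUND» — and that the bookable object is the class theorem WITH the per-pair certificate
`BranchCoeffOneNeZeroAt W p` (discharged per key by two-engine numerics). This file makes that sentence a pair
of kernel theorems about the ROUTE DECLS, so the planner can place item 19499 on the catalogued barrier
`Literature/Barriers/BirchSwinnertonDyer/PAdicHeightNondegeneracy` (Schneider 1985 / Mazur–Stein–Tate Conj. 1.1,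
tree predicate `WeierstrassCurve.SchneiderConjecture`) BY NAME:

* (⇐, §2–§3) `gordTwoRankOneClassCert_of_forall_schneider`: from the nine rank-one PUBLISHED named facts
  already displayed by the cell's doors (`hCyc`, `hCyc3`, `hArt`, `h73`, `hWald`, `hmod`, `hmodD`, `hmodN`,
  `hGZK`) and SCHNEIDER'S CONJECTURE ON THE CELL — `Reg_p(E, Dh) ≠ 0` for every `p`-adic height datum `Dh`
  carrying Delbourgo's Theorem (B) clauses (`LeadingTermClauses W p Dh`, the tree's standard `hSall` shape of
  `BranchPAdicGrossZagierIff` / `CensusX42ValConverse`), on every non-CM pair of cell (G-ord, `e = 2`) of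
  analytic rank `1` — the route decl `GordTwoRankOneClassCert` follows BY NAME. Per pair and per twist model
  (§2): the seat's gen-0 identities `exists_datum_identity{,_odd,_three_intrinsic}_of_facts`
  (`ϖ·[T¹]B·log_p γ = u·q·Reg_p(E,Dh)`, `L′(E,1) = q·Ω_E·Reg_∞`) give `q ≠ 0` from `L′(E,1) ≠ 0`
  (`leadingLCoeff_ne_zero_holds`) and hence `[T¹](ϖ·B) ≠ 0` from `Reg_p ≠ 0` (§1, three factors non-zero).
* (⇒, §4) `forall_schneider_of_gordTwoRankOneClassCert`: conversely the certificate child gives Schneider's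
  conjecture for every datum carrying the twisted-branch Gross–Zagier clauses (`TwistedBranchGrossZagierAt`,
  the Gross–Zagier half of the cell fact `delbourgoDatum_rankOne_leadingTerms`) on every such pair — the gz
  seat's `schneiderConjecture_of_twisted_of_branchCoeffOneNeZero` at the twist model the cell provides
  (`TypeGOrd.exists_goodOrd_pStar_twist_model`).
* (§5) `gordTwoRankOne_of_parts_of_forall_schneider`: the crux BY NAME from `PrintedFacts`, `ReadingFacts`, the
  ten further PUBLISHED facts of the certified seam `gordTwoRankOne_of_parts` (gen 2), the two Λ-adic children
  (items 19497/19498, displayed) and Schneider's conjecture on the cell IN PLACE OF the certificate child —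
  i.e. the honest residual of 19358 in the kernel: {Λ-adic lower containment off Case 1} ∪ {Schneider on the cell}.

What is NOT claimed: Schneider's conjecture (open; Mazur–Stein–Tate 2006 Conj. 1.1); any Λ-adic containment;
anything at class level without one of them. The two directions quantify over the tree's two datum classes
((B)-clauses resp. twisted-GZ clauses) because `PAdicHeightData` is an abstract datum (vacuity discipline of
`Disegni2017.TwistedBranchLeadingTerm`); the cell fact's datum lies in both.

References: [Schneider1985] §2; [MazurSteinTate2006] Conj. 1.1; [Delbourgo2002] Thm. (A), (B) p. 40, `⟨,⟩_{p,ℚ}`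
p. 39; [Delbourgo1998] §2.5 BS-D(p) (i), (ii); [Disegni2017] Thm. A, B; [MazurTateTeitelbaum1986Invent] §I.13–I.14;
[GrossZagier1986] Thm. I.(7.3); [LiLiuTian2024] Thm. 1.1 (i); cell memo PROOF-gz.md §3 (Cor. 3).
-/

set_option autoImplicit false
set_option linter.dupNamespace false

noncomputable section

open scoped Classical MatrixGroups ModularForm NumberField

open CongruenceSubgroup WeierstrassCurve NumberField IsDedekindDomain Field
  Literature.NumberTheory.EllipticCurves Literature.NumberTheory.EllipticCurves.ModularForms
  Literature.NumberTheory.EllipticCurves.GreenbergVatsal2000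
  Literature.NumberTheory.EllipticCurves.Rank1Residual
  Literature.NumberTheory.EllipticCurves.Rank1Residual.Typed
  Literature.NumberTheory.EllipticCurves.Delbourgo2002
  Literature.NumberTheory.EllipticCurves.Disegni2017
  Literature.NumberTheory.GaloisRepresentations
  Summit.BirchSwinnertonDyer.Rank1Residual.AdditivePotMult
  Summit.BirchSwinnertonDyer.Rank1Residual.Additive
  Summit.BirchSwinnertonDyer.BirchSwinnertonDyer.Theses.AdditiveBranchIMC

namespace Summit.BirchSwinnertonDyer.BirchSwinnertonDyer.Theorems.AdditiveBranchIMCGordTwoRankOne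

variable {W : WeierstrassCurve ℚ} [W.IsElliptic] [W.IsGloballyMinimal] {p : ℕ} [hp : Fact p.Prime]

/-! ### §1 Bookkeeping: three non-zero factors -/

/-- Bookkeeping for the twisted-branch identity `ϖ·c·ℓ = u·q·R` (`c = [T¹]B`, `ℓ = log_p γ`): if `u` is a
unit, `q ≠ 0` and `R ≠ 0` then `[T¹](ϖ·B) = ϖ·c ≠ 0`.
[cite: Delbourgo1998, §2.5 BS-D(p) (i), (ii) (pp. 151–152) (shape of the identity)] -/
theorem coeff_one_C_mul_ne_zero_of_identity {ϖ q : ℚ} {B : PowerSeries ℚ_[p]} {u : ℤ_[p]ˣ}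
    {R ℓ : ℚ_[p]}
    (hid : (ϖ : ℚ_[p]) * PowerSeries.coeff 1 B * ℓ = ((u : ℤ_[p]) : ℚ_[p]) * (q : ℚ_[p]) * R)
    (hq : q ≠ 0) (hR : R ≠ 0) :
    PowerSeries.coeff 1 (PowerSeries.C (ϖ : ℚ_[p]) * B) ≠ 0 := by
  have hu : ((u : ℤ_[p]) : ℚ_[p]) ≠ 0 := PadicInt.coe_ne_zero.2 u.ne_zero
  have hq' : (q : ℚ_[p]) ≠ 0 := by exact_mod_cast hq
  have hrhs : ((u : ℤ_[p]) : ℚ_[p]) * (q : ℚ_[p]) * R ≠ 0 := mul_ne_zero (mul_ne_zero hu hq') hR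
  rw [← hid] at hrhs
  rw [PowerSeries.coeff_C_mul]
  exact left_ne_zero_of_mul hrhs

/-! ### §2 Per pair, cell (G-ord, `e = 2`): Schneider on the (B)-datums ⟹ the certificate `A′ ≠ 0` -/

/-- **Schneider's conjecture at the pair ⟹ the analytic certificate `A′ ≠ 0` at the pair** (the converse of
the gz seat's `schneiderConjecture_of_twisted_of_branchCoeffOneNeZero`). `W = E` globally minimal WITHOUT CM
on cell (G-ord, `e = 2`) at the odd prime `p` (`N10.CellGordTwo W p`), `r_an(E) = 1`. IF every `p`-adic height
datum `Dh` on `E(ℚ)` carrying Delbourgo's Theorem (B) clauses has `Reg_p(E,Dh) ≠ 0` (Schneider), THEN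
`BranchCoeffOneNeZeroAt W p`: for EVERY good ordinary twist model `C • V^{(p*)} = W`, newform `f` of `V` and
period ratio `ϖ` of the right parity, `[T¹](ϖ·L_p(f, α_V, ω^{(p−1)/2}, T)) ≠ 0` (plus branch at
`p ≡ 1 (mod 4)`, minus branch at `p ≡ 3 (mod 4)`, `p = 3` included). Proof: the gen-0 identities
`exists_datum_identity{,_odd,_three_intrinsic}_of_facts` at `(V, C, f, ϖ)` produce a (B)-datum `Dh`, `u ∈ ℤ_p^×`,
`q ∈ ℚ` with `L′(E,1) = q·Ω_E·Reg_∞(E)` — so `q ≠ 0` by `leadingLCoeff_ne_zero_holds` — and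
`ϖ·[T¹]B·log_p γ = u·q·Reg_p(E,Dh)`; §1. Inputs PUBLISHED, by name: `hCyc`/`hCyc3` (lit's conjoined
Disegni 2017 Thm. A/B + Delbourgo 2002 Thm. (B) facts), `hArt`, `h73`, `hWald`, modularity (`hmod`, `hmodD`,
`hmodN`), GZK (`hGZK`). Nothing asserted: the Schneider hypothesis `hS` is OPEN (Mazur–Stein–Tate Conj. 1.1).
[cite: Schneider1985, §2 Thm. 2′ (p. 342)] [cite: MazurSteinTate2006, Conj. 1.1]
[cite: Delbourgo2002, Theorem (B) (p. 40)] [cite: Disegni2017, Theorem A (arXiv v3 PDF pp. 7–8), Theorem B (PDF p. 9)]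
[cite: MazurTateTeitelbaum1986Invent, §I.13–I.14] -/
theorem branchCoeffOneNeZeroAt_of_forall_schneider
    (hCyc : delbourgoDatum_cycLineGrossZagier) (hCyc3 : delbourgoDatum_cycLineGrossZagier_intrinsicThree)
    (hArt : rankinSelbergEulerProductHecke_baseChangeDirichlet_eq) (h73 : GrossZagier1986_thm_I_7_3)
    (hWald : waldspurger_exists_heegnerField_twist_ne_zero)
    (hmod : hasEntireLFunction_rat) (hmodD : nonempty_modularParametrizationData)
    (hmodN : exists_isNewformOf) (hGZK : rank_eq_analyticRank_of_analyticRank_le_one)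
    (hc : N10.CellGordTwo W p) (hcm : ¬ W.HasCM) (hr : W.analyticRank = 1)
    (hS : ∀ Dh : PAdicHeightData W p, LeadingTermClauses W p Dh → SchneiderConjecture Dh) :
    BranchCoeffOneNeZeroAt W p := by
  obtain ⟨hp2, haddv, hG, -⟩ := hc
  have hL : W.leadingLCoeff ≠ 0 := W.leadingLCoeff_ne_zero_holds (hmod W)
  have hq_of : ∀ q : ℚ, W.leadingLCoeff = (q : ℂ) * (W.realPeriodRat : ℂ) * (W.regulator : ℂ) → q ≠ 0 := by
    rintro q hq rfl
    apply hL
    rw [hq]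
    simp
  intro V _ _ C hC hord N _ f hf ϖ hϖ
  have hV : GoodOrd V p := ⟨hord.1, hord.2⟩
  by_cases hp3 : p = 3
  · subst hp3
    have hne : ¬ Even ((3 : ℕ) / 2) := by decide
    rw [if_neg hne] at hϖ
    simp only [if_neg hne]
    obtain ⟨Dh, -, hB, u, q, hlead, hid⟩ := exists_datum_identity_three_intrinsic_of_facts hCyc3 hArt h73
      hWald hmod hmodD hmodN hGZK haddv hG hcm hr V C hV hC hf ϖ hϖ
    exact coeff_one_C_mul_ne_zero_of_identity hid (hq_of q hlead) (hS Dh hB)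
  · have hp5 : 5 ≤ p := hp.out.five_le_of_ne_two_of_ne_three hp2 hp3
    have hodd : p % 4 = 1 ∨ p % 4 = 3 := by
      obtain ⟨k, hk⟩ := hp.out.odd_of_ne_two hp2
      omega
    rcases hodd with h1 | h3
    · have hev : Even (p / 2) := ⟨p / 4, by omega⟩
      rw [if_pos hev] at hϖ
      simp only [if_pos hev]
      obtain ⟨Dh, -, hB, u, q, hlead, hid⟩ := exists_datum_identity_of_facts hCyc hArt h73 hWald hmod hmodD
        hmodN hGZK haddv hG h1 hcm hr V C hV hC hf ϖ hϖ
      exact coeff_one_C_mul_ne_zero_of_identity hid (hq_of q hlead) (hS Dh hB)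
    · have hnev : ¬ Even (p / 2) := by
        rintro ⟨k, hk⟩
        omega
      rw [if_neg hnev] at hϖ
      simp only [if_neg hnev]
      obtain ⟨Dh, -, hB, u, q, hlead, hid⟩ := exists_datum_identity_odd_of_facts hCyc hArt h73 hWald hmod
        hmodD hmodN hGZK haddv hG h3 hp5 hcm hr V C hV hC hf ϖ hϖ
      exact coeff_one_C_mul_ne_zero_of_identity hid (hq_of q hlead) (hS Dh hB)

/-! ### §3 Class level: the certificate child `GordTwoRankOneClassCert` (item 19499) ⟸ Schneider on the cell -/

/-- **Item 19499 `GordTwoRankOneClassCert` BY NAME from PUBLISHED facts + SCHNEIDER'S CONJECTURE ON THE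
CELL.** GRANTED, on every non-CM pair `(E, p)` of cell (G-ord, `e = 2`) (`N10.CellGordTwo`, `p` odd additive,
semistability defect `2`) with `ord_{s=1} L(E,s) = 1`, that every `p`-adic height datum carrying Delbourgo's
Theorem (B) clauses is non-degenerate (`Reg_p(E,Dh) ≠ 0` — Schneider's conjecture for Delbourgo's
`⟨,⟩_{p,ℚ}`; OPEN, displayed as `hSch`), the route's certificate child holds: `A′ ≠ 0` on every such pair.
Together with §4 this is the kernel form of the cell's H3: the child 19499 is EXACTLY the Schneider barrier
`Literature/Barriers/BirchSwinnertonDyer/PAdicHeightNondegeneracy` restricted to this cell (modulo the nine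
PUBLISHED facts). Nothing asserted. [cite: Schneider1985, §2 Thm. 2′ (p. 342)] [cite: MazurSteinTate2006, Conj. 1.1]
[cite: Delbourgo2002, Theorem (B) (p. 40)] [cite: Disegni2017, Theorem A/B] -/
theorem gordTwoRankOneClassCert_of_forall_schneider
    (hCyc : delbourgoDatum_cycLineGrossZagier) (hCyc3 : delbourgoDatum_cycLineGrossZagier_intrinsicThree)
    (hArt : rankinSelbergEulerProductHecke_baseChangeDirichlet_eq) (h73 : GrossZagier1986_thm_I_7_3)
    (hWald : waldspurger_exists_heegnerField_twist_ne_zero)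
    (hmod : hasEntireLFunction_rat) (hmodD : nonempty_modularParametrizationData)
    (hmodN : exists_isNewformOf) (hGZK : rank_eq_analyticRank_of_analyticRank_le_one)
    (hSch : ∀ (W : WeierstrassCurve ℚ) [W.IsElliptic] [W.IsGloballyMinimal] (p : ℕ) [Fact p.Prime],
      W.analyticRank = 1 → N10.CellGordTwo W p → ¬ W.HasCM →
      ∀ Dh : PAdicHeightData W p, LeadingTermClauses W p Dh → SchneiderConjecture Dh) :
    GordTwoRankOneClassCert :=
  fun W _ _ p _ hr hc hcm ↦
    branchCoeffOneNeZeroAt_of_forall_schneider hCyc hCyc3 hArt h73 hWald hmod hmodD hmodN hGZK hc hcm hr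
      (hSch W p hr hc hcm)

/-! ### §4 Conversely: the certificate ⟹ Schneider for the twisted-Gross–Zagier datums -/

/-- **The certificate at the pair ⟹ Schneider's conjecture for every datum carrying the twisted-branch
Gross–Zagier clauses** (gz's `schneiderConjecture_of_twisted_of_branchCoeffOneNeZero`, with the good ordinary
twist model supplied by the cell: `TypeGOrd.exists_goodOrd_pStar_twist_model`). `W = E` on cell (G-ord,
`e = 2`), `r_an = 1`; `Dh` with `TwistedBranchGrossZagierAt W p Dh` (the Gross–Zagier half of the cell fact
`delbourgoDatum_rankOne_leadingTerms`); `BranchCoeffOneNeZeroAt W p` ⟹ `Reg_p(E,Dh) ≠ 0`.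
[cite: Delbourgo1998, §2.5 BS-D(p) (i), (ii) (pp. 151–152)] [cite: Disegni2017, Thm. B (§1.3.2)]
[cite: MazurTateTeitelbaum1986Invent, §I.13–I.14] -/
theorem schneiderConjecture_of_cellGordTwo_of_branchCoeffOneNeZero
    (hmodD : nonempty_modularParametrizationData) (hc : N10.CellGordTwo W p) (hr : W.analyticRank = 1)
    {Dh : PAdicHeightData W p} (hTw : TwistedBranchGrossZagierAt W p Dh) (hne : BranchCoeffOneNeZeroAt W p) :
    SchneiderConjecture Dh := by
  obtain ⟨hp2, haddv, hG, he⟩ := hc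
  obtain ⟨V, _, _, C, hV, hC⟩ := TypeGOrd.exists_goodOrd_pStar_twist_model W p hp2 hG haddv he
  exact schneiderConjecture_of_twisted_of_branchCoeffOneNeZero hp2 hmodD hr hTw hne V C hC ⟨hV.1, hV.2⟩

/-- **Item 19499 ⟹ Schneider's conjecture on the cell** (for the twisted-Gross–Zagier datums): if the
certificate child `GordTwoRankOneClassCert` holds then on every non-CM pair of cell (G-ord, `e = 2`) with
`r_an = 1`, every datum carrying `TwistedBranchGrossZagierAt` is non-degenerate. With §3: the child and
Schneider-on-the-cell are the same statement modulo PUBLISHED facts (up to the two datum classes of the tree,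
both met by the cell fact's datum). [cite: Schneider1985, §2 Thm. 2′ (p. 342)] [cite: MazurSteinTate2006, Conj. 1.1]
[cite: Disegni2017, Thm. B (§1.3.2)] -/
theorem forall_schneider_of_gordTwoRankOneClassCert (hmodD : nonempty_modularParametrizationData)
    (hCert : GordTwoRankOneClassCert) :
    ∀ (W : WeierstrassCurve ℚ) [W.IsElliptic] [W.IsGloballyMinimal] (p : ℕ) [Fact p.Prime],
      W.analyticRank = 1 → N10.CellGordTwo W p → ¬ W.HasCM →
      ∀ Dh : PAdicHeightData W p, TwistedBranchGrossZagierAt W p Dh → SchneiderConjecture Dh :=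
  fun W _ _ p _ hr hc hcm _Dh hTw ↦
    schneiderConjecture_of_cellGordTwo_of_branchCoeffOneNeZero hmodD hc hr hTw (hCert W p hr hc hcm)

/-! ### §5 The crux BY NAME with Schneider in place of the certificate child -/

/-- **Crux `GordTwoRankOne` (item 19358) BY NAME from the certified seam with SCHNEIDER ON THE CELL in place
of the certificate child.** Inputs: the route's support items `PrintedFacts`, `ReadingFacts`; the ten further
PUBLISHED rank-one facts of `gordTwoRankOne_of_parts` (`hMaz`, `hCyc`, `hCyc3`, `hArt`, `h73`, `hWald`, `hDel`,
`hDel3`, `hmodN`, `hLLT`); the two Λ-adic children (items 19497 `GordTwoLambdaEven` / 19498 `GordTwoLambdaOdd`,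
displayed as `hΛ`, `hΛ'`; NOT in print); and Schneider's conjecture on the non-CM rank-one pairs of the cell
(`hSch`, OPEN). So the honest residual of 19358 in the kernel reads: {Λ-adic branch lower containment off
Case 1} ∪ {Schneider's `p`-adic height non-degeneracy on the cell}; the per-key certificates the cell books
discharge the second class by class. Nothing asserted. [cite: Schneider1985, §2 Thm. 2′ (p. 342)]
[cite: MazurSteinTate2006, Conj. 1.1] [cite: LiLiuTian2024, Thm. 1.1 (i)] [cite: Delbourgo2002, Theorem (A), (B) (p. 40)]
[cite: Mazur1972Towers, Cor. 5.15] [cite: SkinnerUrban2014, Thm. 3.6.4 (p. 43) (shape only; nothing asserted)] -/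
theorem gordTwoRankOne_of_parts_of_forall_schneider (hP : PrintedFacts) (hR : ReadingFacts)
    (hMaz : Mazur1972.cor515_universalNormIndex) (hCyc : delbourgoDatum_cycLineGrossZagier)
    (hCyc3 : delbourgoDatum_cycLineGrossZagier_intrinsicThree)
    (hArt : rankinSelbergEulerProductHecke_baseChangeDirichlet_eq) (h73 : GrossZagier1986_thm_I_7_3)
    (hWald : waldspurger_exists_heegnerField_twist_ne_zero) (hDel : Delbourgo2002.mainTheorem)
    (hDel3 : Delbourgo2002.mainTheorem_three) (hmodN : exists_isNewformOf)
    (hLLT : LiLiuTian2024.thm11_bsdp_of_cm_rank_one)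
    (hΛ : ∀ (W : WeierstrassCurve ℚ) [W.IsElliptic] [W.IsGloballyMinimal] (p : ℕ) [Fact p.Prime],
      N10.CellGordTwo W p → ¬ HasCaseOneMember W p → p % 4 = 1 → ChiBranchLowerDivisibilityAt W p)
    (hΛ' : ∀ (W : WeierstrassCurve ℚ) [W.IsElliptic] [W.IsGloballyMinimal] (p : ℕ) [Fact p.Prime],
      N10.CellGordTwo W p → ¬ HasCaseOneMember W p → p % 4 = 3 → ChiBranchLowerDivisibilityOddAt W p)
    (hSch : ∀ (W : WeierstrassCurve ℚ) [W.IsElliptic] [W.IsGloballyMinimal] (p : ℕ) [Fact p.Prime],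
      W.analyticRank = 1 → N10.CellGordTwo W p → ¬ W.HasCM →
      ∀ Dh : PAdicHeightData W p, LeadingTermClauses W p Dh → SchneiderConjecture Dh) :
    GordTwoRankOne := by
  obtain ⟨-, -, -, -, hGZK, hmod, hmodD, -⟩ := id hP
  exact gordTwoRankOne_of_parts hP hR hMaz hCyc hCyc3 hArt h73 hWald hDel hDel3 hmodN hLLT hΛ hΛ'
    (gordTwoRankOneClassCert_of_forall_schneider hCyc hCyc3 hArt h73 hWald hmod hmodD hmodN hGZK hSch)

end Summit.BirchSwinnertonDyer.BirchSwinnertonDyer.Theorems.AdditiveBranchIMCGordTwoRankOne
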